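import Mathlib
import Summits.Ventures.PercRepro2.Defs
import Summits.Ventures.PercRepro2.Graph
import Summits.Ventures.PercRepro2.OneColourSwitch
import Summits.Ventures.PercRepro2.RegionHubSign
import Summits.Ventures.PercRepro2.SideSwitch
import Summits.Ventures.PercRepro2.TermSwitchDefs
import Summits.Ventures.PercRepro2.M9NoPocketDefs
import Summits.Ventures.PercRepro2.M9PsiOneDefs
import Summits.Ventures.PercRepro2.M9PsiOneWorlds
import Summits.Ventures.PercRepro2.M9PsiOneLink
import Summits.Ventures.PercRepro2.M9PsiOneInj
import Summits.Ventures.PercRepro2.M9PsiTwoDefs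
import Summits.Ventures.PercRepro2.M9PsiTwoWorlds

/-!
# The second partner `Ψ₂ ω` has no `W`-link (blind cell PercRepro2, p3 g34, 2026-08-29;
`proofs/P3-REST2.md` §1, claim (ii), first half)

Block facts for the flipped set (the block of a joined or linking `W`-vertex lies in the flipped
set), the transfer of `Y`-connections of `ω` to `Ψ₂ ω` (`conn_psiTwo_of_conn`: every `Y`-path of
`ω` ending outside the `W`-core and the outside uses edges kept by `Ψ₂`), and the first half of
claim (ii): for an `EX` colouring without an edge `r–s`, **`Ψ₂ ω` has no `W`-link**
(`not_conn_compl_psiTwo`) — a `W`-path `r → s` of `Ψ₂ ω` stays in the unflipped `W`-core, where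
`Ψ₂` keeps every edge, so it is a `W`-path of `ω` inside one block, whose vertices are then
`W`-linking and flipped.  The `Y`-link of `Ψ₂ ω` is `M9PsiTwoLink`.  Own work; std axioms.
-/

namespace Summit.Ventures.PercRepro2

namespace NoPocket

open Finset Classical RegionHub OneColourSwitch SideSwitch TermSwitch

variable {V : Type*} {E : Type*}

section Blocks

variable {ends : E → Sym2 V} {r s d : V} {ω : Config E}

/-- The block (inside the `W`-core) of a joined `W`-vertex lies in the joined `W`-set. -/
lemma blockIn_subset_joinedW {x : V} (hx : x ∈ joinedW ends r s d ω) :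
    blockIn ends (Mcore ends r s d ω) x ⊆ joinedW ends r s d ω := by
  intro y hy
  obtain ⟨h₀, hh₀, hc⟩ := hx
  exact ⟨h₀, hh₀, conn_trans hc hy⟩

/-- The block (inside the `W`-core) of a `W`-linking vertex lies in the linking set. -/
lemma blockIn_subset_linkSetW {x : V} (hx : x ∈ linkSetW ends r s d ω) :
    blockIn ends (Mcore ends r s d ω) x ⊆ linkSetW ends r s d ω := by
  intro y hy
  have hyM : y ∈ Mcore ends r s d ω := expl_allIn_subset (H := {x}) (by
    intro z hz; rw [Set.mem_singleton_iff] at hz; rw [hz]; exact hx.1) ⟨x, rfl, hy⟩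
  refine ⟨hyM, ?_⟩
  rw [← blockIn_eq_of_conn hy]
  exact hx.2

/-- The block of a flipped vertex lies in the flipped set. -/
lemma blockIn_subset_flipSetW {x : V} (hx : x ∈ flipSetW ends r s d ω) :
    blockIn ends (Mcore ends r s d ω) x ⊆ flipSetW ends r s d ω := by
  rcases hx with hx | hx
  · exact fun y hy => Or.inl (blockIn_subset_joinedW hx hy)
  · exact fun y hy => Or.inr (blockIn_subset_linkSetW hx hy)

/-- A vertex of the block of a `W`-core vertex is a `W`-core vertex. -/
lemma mem_Mcore_of_mem_blockIn {x y : V} (hx : x ∈ Mcore ends r s d ω)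
    (hy : y ∈ blockIn ends (Mcore ends r s d ω) x) : y ∈ Mcore ends r s d ω :=
  expl_allIn_subset (H := {x}) (by
    intro z hz; rw [Set.mem_singleton_iff] at hz; rw [hz]; exact hx) ⟨x, rfl, hy⟩

end Blocks

section Link

variable {ends : E → Sym2 V} {p q r s d : V} {ω : Config E}

variable (h : IsEX ends p q r s d ω)
include h

/-- An edge between two terminals is kept by `Ψ₂` (it touches no `W`-core vertex and is not at
`d`). -/
lemma psiTwo_term_term {t t' : V} {e : E} (ht : t = r ∨ t = s) (ht' : t' = r ∨ t' = s)
    (hends : ends e = s(t, t')) : psiTwo ends r s d ω e = ω e :=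
  psiTwo_of_not_flipped (not_mem_flippedW_of_not_touches hends
    (fun hF => term_not_mem_Mcore ht (flipSetW_subset_Mcore hF))
    (fun hF => term_not_mem_Mcore ht' (flipSetW_subset_Mcore hF))
    (by rcases ht with rfl | rfl <;> [exact h.hr.symm; exact h.hs.symm])
    (by rcases ht' with rfl | rfl <;> [exact h.hr.symm; exact h.hs.symm]))

/-- **`Y`-connections of `ω` ending outside the `W`-core and the outside transfer to `Ψ₂ ω`**:
the set `{z | v ~_Y z in Ψ₂ ω} ∪ Mcore ∪ Outside` is closed under the open edges of `ω`. -/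
lemma conn_psiTwo_of_conn {v u : V} (hc : Conn ends ω v u) (huM : u ∉ Mcore ends r s d ω)
    (huO : u ∉ Outside ends r s ω) : Conn ends (psiTwo ends r s d ω) v u := by
  have key : u ∈ {z | Conn ends (psiTwo ends r s d ω) v z ∨ z ∈ Mcore ends r s d ω ∨
      z ∈ Outside ends r s ω} := by
    refine mem_of_conn_of_closed (ends := ends) (ω := ω) ?_ (Or.inl (conn_refl _ _ _)) hc
    intro x hx y hxy
    obtain ⟨hne, e, he, hends⟩ := openGraph_adj.1 hxy
    -- the edge `x–y` is open in `ω`; show `y` is in the set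
    rcases vertex_cases (ends := ends) (r := r) (s := s) (d := d) (ω := ω) y with
      hy | hy | hy | hyK | hyM | hyO
    · -- `y = r`
      left
      rcases hx with hx | hx | hx
      · rcases vertex_cases (ends := ends) (r := r) (s := s) (d := d) (ω := ω) x with
          hx' | hx' | hx' | hxK | hxM | hxO
        · exact (hne (hx'.trans hy.symm)).elim
        · refine conn_trans hx (conn_of_openAdj ⟨e, ?_, hends⟩)
          rw [psiTwo_term_term h (Or.inr hx') (hy ▸ Or.inl rfl) hends]; exact he
        · exact (no_edge_d_term h (Or.inl hy) (hx' ▸ hends)).elim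
        · refine conn_trans hx (conn_of_openAdj ⟨e, ?_, hends⟩)
          rw [psiTwo_Kcore h hxK hends]; exact he
        · rw [edge_Mcore_term h hxM (Or.inl hy) hends] at he; exact (Bool.false_ne_true he).elim
        · exact (no_edge_out_term h hxO (Or.inl hy) (ends_swap hends)).elim
      · rw [edge_Mcore_term h hx (Or.inl hy) hends] at he; exact (Bool.false_ne_true he).elim
      · exact (no_edge_out_term h hx (Or.inl hy) (ends_swap hends)).elim
    · -- `y = s`
      left
      rcases hx with hx | hx | hx
      · rcases vertex_cases (ends := ends) (r := r) (s := s) (d := d) (ω := ω) x with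
          hx' | hx' | hx' | hxK | hxM | hxO
        · refine conn_trans hx (conn_of_openAdj ⟨e, ?_, hends⟩)
          rw [psiTwo_term_term h (Or.inl hx') (hy ▸ Or.inr rfl) hends]; exact he
        · exact (hne (hx'.trans hy.symm)).elim
        · exact (no_edge_d_term h (Or.inr hy) (hx' ▸ hends)).elim
        · refine conn_trans hx (conn_of_openAdj ⟨e, ?_, hends⟩)
          rw [psiTwo_Kcore h hxK hends]; exact he
        · rw [edge_Mcore_term h hxM (Or.inr hy) hends] at he; exact (Bool.false_ne_true he).elim
        · exact (no_edge_out_term h hxO (Or.inr hy) (ends_swap hends)).elim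
      · rw [edge_Mcore_term h hx (Or.inr hy) hends] at he; exact (Bool.false_ne_true he).elim
      · exact (no_edge_out_term h hx (Or.inr hy) (ends_swap hends)).elim
    · -- `y = d`
      left
      rw [hy] at hends ⊢
      rcases hx with hx | hx | hx
      · rcases vertex_cases (ends := ends) (r := r) (s := s) (d := d) (ω := ω) x with
          hx' | hx' | hx' | hxK | hxM | hxO
        · exact (no_edge_d_term h (Or.inl hx') (ends_swap hends)).elim
        · exact (no_edge_d_term h (Or.inr hx') (ends_swap hends)).elim
        · exact (hne (hx'.trans hy.symm)).elim
        · refine conn_trans hx (conn_of_openAdj ⟨e, ?_, hends⟩)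
          rw [psiTwo_d_Kcore h hxK (ends_swap hends)]; exact he
        · rw [edge_Mcore_d h hxM hends] at he; exact (Bool.false_ne_true he).elim
        · exact (no_edge_d_out h hxO (ends_swap hends)).elim
      · rw [edge_Mcore_d h hx hends] at he; exact (Bool.false_ne_true he).elim
      · exact (no_edge_d_out h hx (ends_swap hends)).elim
    · -- `y` in the `Y`-core: the edge is kept
      left
      have he' : psiTwo ends r s d ω e = true := by
        rw [psiTwo_Kcore h hyK (ends_swap hends)]; exact he
      rcases hx with hx | hx | hx
      · exact conn_trans hx (conn_of_openAdj ⟨e, he', hends⟩)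
      · exact (no_edge_core_core h hyK hx (ends_swap hends)).elim
      · rw [edge_Kcore_out hyK hx (ends_swap hends)] at he; exact (Bool.false_ne_true he).elim
    · exact Or.inr (Or.inl hyM)
    · exact Or.inr (Or.inr hyO)
  rcases key with hk | hk | hk
  · exact hk
  · exact (huM hk).elim
  · exact (huO hk).elim

omit h in
/-- Two adjacent `W`-core vertices lie in the same block. -/
lemma blockIn_eq_of_Mcore_edge {x y : V} {e : E} (hx : x ∈ Mcore ends r s d ω)
    (hy : y ∈ Mcore ends r s d ω) (hends : ends e = s(x, y)) :
    blockIn ends (Mcore ends r s d ω) x = blockIn ends (Mcore ends r s d ω) y :=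
  blockIn_eq_of_conn (conn_allIn_of_edge hx hy hends)

omit h in
/-- An edge inside `S` is open in `restrictTo ω S` iff open in `ω` (the `W`-version). -/
lemma restrictTo_compl_eq {S : Set V} {x y : V} {e : E} (hx : x ∈ S) (hy : y ∈ S)
    (hends : ends e = s(x, y)) :
    restrictTo ends (OneColourSwitch.compl ω) S e = !ω e := by
  unfold restrictTo; rw [if_pos ⟨x, hx, y, hy, hends⟩]; rfl

/-- **No `W`-link in `Ψ₂ ω`** (no edge `r–s`): the set of vertices reached from `r` by closed
edges of `Ψ₂ ω` consists of `r` and of unflipped `W`-core vertices `W`-rooted at `r` inside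
their block; `s` is never reached, a block reaching `s` being `W`-linking, hence flipped. -/
theorem not_conn_compl_psiTwo (hrs : ∀ e, ends e ≠ s(r, s)) :
    ¬ Conn ends (OneColourSwitch.compl (psiTwo ends r s d ω)) r s := by
  intro hc
  have key : s ∈ {z | z = r ∨ (z ∈ Mcore ends r s d ω ∧ z ∉ flipSetW ends r s d ω ∧
      Conn ends (restrictTo ends (OneColourSwitch.compl ω)
        (blockIn ends (Mcore ends r s d ω) z ∪ {r, s})) r z)} := by
    refine mem_of_conn_of_closed (ends := ends) ?_ (Or.inl rfl) hc
    intro x hx y hxy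
    obtain ⟨hne, e, he, hends⟩ := openGraph_adj.1 hxy
    have he' : psiTwo ends r s d ω e = false := by simpa [OneColourSwitch.compl] using he
    rcases vertex_cases (ends := ends) (r := r) (s := s) (d := d) (ω := ω) y with
      hy | hy | hy | hyK | hyM | hyO
    · exact Or.inl hy
    · -- `y = s`: impossible
      exfalso
      rcases hx with hx | ⟨hxM, hxF, hxc⟩
      · exact hrs e (by rw [hends, hx, hy])
      · -- the edge `x–s` is kept and closed in `ω`: `x` is `W`-linking
        have hω : ω e = false := by
          rw [← psiTwo_Mcore_kept h hxM hxF hends]; exact he'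
        have hxs : Conn ends (restrictTo ends (OneColourSwitch.compl ω)
            (blockIn ends (Mcore ends r s d ω) x ∪ {r, s})) x s := by
          refine conn_of_openAdj ⟨e, ?_, hy ▸ hends⟩
          rw [restrictTo_compl_eq (S := blockIn ends (Mcore ends r s d ω) x ∪ {r, s}) (Or.inl (mem_blockIn_self _ _)) (by simp) (hy ▸ hends), hω]
          rfl
        exact hxF (Or.inr ⟨hxM, conn_trans hxc hxs⟩)
    · -- `y = d`: impossible
      exfalso
      rcases hx with hx | ⟨hxM, hxF, _⟩
      · exact no_edge_d_term h (Or.inl hx) (ends_swap (hy ▸ hends))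
      · exact hxF (mem_flipSetW_of_adj_d hxM (hy ▸ hends))
    · -- `y` in the `Y`-core: impossible
      exfalso
      rcases hx with hx | ⟨hxM, _, _⟩
      · rw [psiTwo_term_Kcore h (Or.inl hx) hyK hends] at he'
        exact Bool.false_ne_true he'.symm
      · exact no_edge_core_core h hyK hxM (ends_swap hends)
    · -- `y` in the `W`-core: unflipped, rooted at `r`
      right
      rcases hx with hx | ⟨hxM, hxF, hxc⟩
      · have hyF : y ∉ flipSetW ends r s d ω := by
          intro hyF
          rw [psiTwo_term_Mcore h (Or.inl hx) hyM hends, if_pos hyF] at he'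
          exact Bool.false_ne_true he'.symm
        have hω : ω e = false := by
          rw [← psiTwo_Mcore_kept h hyM hyF (ends_swap hends)]; exact he'
        refine ⟨hyM, hyF, conn_of_openAdj ⟨e, ?_, hx ▸ hends⟩⟩
        rw [restrictTo_compl_eq (S := blockIn ends (Mcore ends r s d ω) y ∪ {r, s}) (by simp) (Or.inl (mem_blockIn_self _ _)) (hx ▸ hends), hω]
        rfl
      · have hyF : y ∉ flipSetW ends r s d ω := fun hyF => hxF (mem_flipSetW_of_edge' hyF hxM hends)
        have hω : ω e = false := by
          rw [← psiTwo_Mcore_kept h hxM hxF hends]; exact he'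
        have hblk := blockIn_eq_of_Mcore_edge hxM hyM hends
        refine ⟨hyM, hyF, ?_⟩
        rw [← hblk]
        refine conn_trans hxc (conn_of_openAdj ⟨e, ?_, hends⟩)
        rw [restrictTo_compl_eq (S := blockIn ends (Mcore ends r s d ω) x ∪ {r, s}) (Or.inl (mem_blockIn_self _ _)) (Or.inl (hblk ▸ mem_blockIn_self _ _)) hends, hω]
        rfl
    · -- `y` outside: impossible
      exfalso
      rcases hx with hx | ⟨hxM, hxF, _⟩
      · exact no_edge_out_term h hyO (Or.inl hx) hends
      · rw [psiTwo_Mcore_kept h hxM hxF hends, edge_Mcore_out hxM hyO hends] at he'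
        exact Bool.false_ne_true he'.symm
  rcases key with hk | ⟨hk, _, _⟩
  · exact h.hrs hk.symm
  · exact term_not_mem_Mcore (Or.inr rfl) hk

end Link

end NoPocket

end Summit.Ventures.PercRepro2
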